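import Summits.HodgeConjecture.HodgeConjecture.Theorems.R90S4EpsRegularStablePartition    -- ★ p864343 (C10-p03) (P3) `exists_normTube_representatives`, (P4) `integral_eq_sum_integral_normTube` (brings ★ TUBE-EQ `R90S4EpsTubeEq`, COVER-ε, `IsStableTransportDict`)
import Summits.HodgeConjecture.HodgeConjecture.Theorems.R90S4StableRegroupOfPlain          -- ★ (K2E3-p12) (B2-S): `stableCartanMeasure_eq_sum`, `pos_of_bijOn_stableIndexSet` (brings ★ `stableCartanMeasure`, `cartanWeight`, `measurable_cartanWeight`)
import Summits.HodgeConjecture.HodgeConjecture.Theorems.R90S4StableEpsOrbitalClassFunction -- ★ (K2E3-p31) `setIntegral_cartanWeight_smul_stableEpsOrbitalIntegral_mul_eq_of_transport` (brings ★ `stableEpsOrbitalIntegral`, `IsStablyEpsConjAt`)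
import Summits.HodgeConjecture.HodgeConjecture.Theorems.R90S4WeylCountTLetter              -- ★ p864300 (K2E3-p12) (WEYL-COUNT-T) letter `IsTwistedWeylCountT`
import Summits.HodgeConjecture.HodgeConjecture.Theorems.R90S4EpsWeylFinite                 -- ★ p864025 (p05) WEYL-ε: `exists_epsNormalizer`, `index_centralizer_subgroupOf_epsNormalizer_ne_zero`
import Summits.HodgeConjecture.HodgeConjecture.Theorems.R90S4NormStableClassBijection       -- ★ `exists_epsNorm_eq_coe`
import Summits.HodgeConjecture.HodgeConjecture.Theorems.R90S4OneDimCharTransferOfWeylPair  -- ★ `IsTwistedWeylMeasure` (the (B1) predicate of ★ p863508 `weylNormPair_of_stable_twisted`)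
import HarnessLib

/-!
# R90-TF · S4 «Ch. 13.1–2», T-WIF road, (B1-Σ) core — THE TWISTED WEYL INTEGRATION FORMULA ASSEMBLED OVER THE STABLE CLASSES OF CARTAN SUBGROUPS, FROM THE ONE-TUBE FORMULAS
# (Rogawski 1990, §12.5 p. 186: «`∫_{G̃} φβ = Σ_{T} |W̃|⁻¹ ∫_T D² Φ^{st}_ε β`», regrouped on the stable Cartan measure of p. 182)

Cell `hodgecm-mathlib`, crux H413 (`stmt-HodgeConjecture-24833`, lane `--supports … --as helper`), route of record `HCCMUnconditional` (no route verbs;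
count-neutral).  Programme R90-TF, section S4 = [Rogawski1990] Ch. 13.1–13.2; seat R90-C131-p03 (g3); plan of record S4-R30∕S4-R33, census `R90/R90-C131-p03/g3/CENSUS-B1-assembly.md` §4,
bus 2026-09-05 03:13:21Z (2) (Σ-core ∕ Σ-head split).  THEOREMS ONLY — no `def`, no instance, no notation, no named-fact hypothesis, no `sorry`; ★-only imports.

HONEST LABEL: HC_CM is proved only modulo the 7 printed citations (2 remaining named inputs: hLiu418 = stmt-HodgeConjecture-24832, h413 =
stmt-HodgeConjecture-24833) until rung 0 closes.  CONDITIONAL on (WEYL-COUNT-T) (`IsTwistedWeylCountT`, hypothesis `hwc`) and on the ONE-TUBE FORMULAS (hypothesis `hone`, one per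
member — paid from the Jacobian letter (J̃♭) by part 3 of (B1-T) in the Σ-head file, or from its (3′) twin); SING-ε is the hypothesis `hsing` (discharged for non-split `v` by ★ p864222).
Discharges no socket by itself (REL ≠ ★ ≠ BUILT).

## The mathematics

DATA: a Cartan system `C` of `G_v = U(Φ₃)(L⁺_v)` with the ★ CARTAN-ALL letters `hZ` (`T = Z(γ₀)`, `γ₀` regular), `hcov`, `hirr`; core-one Haar measures `tT` on the members; a
stable-transport dictionary for `(C, n)` (★ `IsStableTransportDict`: transports `e_{i,j} : T_i ≃ₜ* T_{τ i j}`, weights and stable classes respected, `n = m_T` on `T^{reg}`); a Haar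
measure `νGt` on `G̃_v` with SING-ε; an ε-orbital family `mGt`; a norm section `sec₀`; the stable Cartan measure `ρ := stableCartanMeasure L v C tT n` (p. 182).
THE ONE-TUBE FORMULA OF A MEMBER `T_i = Z(γ₀)` (hypothesis `hone i`, for every ε-normaliser `Ñ` of `T̃_i = Cent_{G̃_v}(γ₀)`): for `φβ` integrable and `β` ε-stable,
`J_i(φ, β) := ∫_{T_i^{reg}} D_{T_i}(t) • Φ^{st}_ε(sec₀ t, φ) β(sec₀ t) dt_{T_i}` converges and `[Ñ : T̃_i] · ∫_{tube T_i} φ β dνGt = J_i(φ, β)`, `tube T_i := {δ | N δ ∼ t, t ∈ T_i^{reg}}`.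
THE HEAD: `IsTwistedWeylMeasure L Φ₃ v νGt mGt ρ sec₀`, i.e. for `φ ∈ C_c^∞(G̃_v)` and continuous ε-stable `β`: **`∫_{G̃_v} φ β dνGt = ∫ Φ^{st}_ε(sec₀ γ, φ) β(sec₀ γ) dρ(γ)`**.
PROOF (p. 186 regrouped à la p. 182).  (1) ★ (P3)∕(P4): the ε-regular set is the disjoint union of the tubes of a set `K ⊆ C` of representatives of the STABLE classes of members, and
SING-ε makes `∫_{G̃_v} φβ = Σ_{k ∈ K} ∫_{tube k} φβ`.  (2) ONE-TUBE at each `k ∈ K` with an ε-normaliser `Ñ_k` (★ `exists_epsNormalizer`; `[Ñ_k : T̃_k] ≠ 0` ★ WEYL-ε):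
`∫_{tube k} φβ = [Ñ_k : T̃_k]⁻¹ J_k`.  (3) (WEYL-COUNT-T) at the regular family `γ₀`: `[Ñ_k : T̃_k]⁻¹ = Σ_{i ∼_{st} k} ([N(T_i):T_i] · m_i)⁻¹` (`n(γ₀ i) = m_i`, dictionary clause (N)).
(4) TRANSPORT: if `T_i ∼_{st} T_k` the dictionary yields `e : T_i ≃ₜ* T_k` respecting stable classes and weights (★ `exists_transport_of_isStablyConjGAt_of_dict`), and the core-one Haar
measures correspond, so `J_i = J_k` (★ `setIntegral_cartanWeight_smul_stableEpsOrbitalIntegral_mul_eq_of_transport`: `γ ↦ Φ^{st}_ε(sec₀ γ, φ) β(sec₀ γ)` is a stable class function).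
(5) PARTITION: the classes `S_k := {i | T_i ∼_{st} T_k}`, `k ∈ K`, partition `C` — every `T_i` meets some representative's tube through a `δ` with `N δ = γ₀ i` (★ `exists_epsNorm_eq_coe`,
two norms of one `δ` are stably conjugate ★), and two representatives reached from one `T_i` would have equal, not disjoint, tubes (★ `exists_norm_mem_iff_of_transport`).  Hence
`∫ φβ = Σ_{k ∈ K} Σ_{i ∈ S_k} ([N(T_i):T_i] m_i)⁻¹ J_i = Σ_{i ∈ C} ([N(T_i):T_i] m_i)⁻¹ J_i`.  (6) The right side is `∫ G dρ` unpacked by ★ `stableCartanMeasure_eq_sum`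
(`ρ = Σ_i ([N(T_i):T_i] m_i)⁻¹ • (ι_i)_*(D_{T_i} · t_{T_i}|_{reg})`), the member integrability being the first half of ONE-TUBE.

[cite: Rogawski1990, §12.5 pp. 182, 186–187; §4.3 (4.3.1) p. 43; §3.6 pp. 28–31; §3.11 Prop. 3.11.1 pp. 34–35] [cite: HarishChandra1970, Lemma 22; Lemma 42]
-/

set_option autoImplicit false
-- the mandated namespace repeats the single-problem summit's segment (`HodgeConjecture.HodgeConjecture`)
set_option linter.dupNamespace false

noncomputable section

open MeasureTheory Measure Set Filter Topology Function NumberField IsDedekindDomain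
open Literature.MeasureTheory.Group
open Literature.NumberTheory.Automorphic Literature.NumberTheory.Automorphic.UnitaryGroup Literature.NumberTheory.Rogawski1990
open Literature.NumberTheory.Rogawski1990.Ch4Sec10
open Summit.HodgeConjecture.HodgeConjecture.Cruxes.H413
open Summit.HodgeConjecture.HodgeConjecture.Cruxes.H413.F0P3cStCharTSWeylCartanRadial
open scoped ENNReal NNReal MatrixGroups Pointwise

namespace Summit.HodgeConjecture.HodgeConjecture.R90.S4

section SigmaCore

variable (L : Type) [Field L] [NumberField L] [IsCMField L] (v : HeightOneSpectrum (𝓞 ↥(maximalRealSubfield L)))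

/-- **(B1-Σ) CORE — THE TWISTED WEYL INTEGRATION FORMULA ON THE STABLE CARTAN MEASURE, FROM THE ONE-TUBE FORMULAS** (Rogawski §12.5 p. 186, regrouped over the stable classes of
Cartan subgroups as on p. 182).  `v` non-split (`hns`); `C` a Cartan system with the ★ CARTAN-ALL letters `hZ`, `hcov`, `hirr`; `tT` core-one Haar measures on the members; `(C, n)` with a
stable-transport dictionary; `νGt` a Haar measure on `G̃_v` with SING-ε (`hsing`); `mGt` an ε-orbital family; `sec₀` a norm section; (WEYL-COUNT-T) `hwc`; and for every member the
ONE-TUBE FORMULA `hone` (integrability of `D_T • Φ^{st}_ε(sec₀ ·) β(sec₀ ·)` on `T^{reg}` and `[Ñ : T̃] · ∫_{tube T} φβ dνGt = ∫_{T^{reg}} D_T • Φ^{st}_ε(sec₀ t) β(sec₀ t) dt_T` for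
every ε-normaliser `Ñ`, every integrable `φβ` with `β` ε-stable).  THEN `(stableCartanMeasure L v C tT n, sec₀)` IS A TWISTED WEYL DATUM:
**`IsTwistedWeylMeasure L (splitFormGL L) v νGt mGt (stableCartanMeasure L v C tT n) sec₀`** — the `hT` input of ★ p863508 `weylNormPair_of_stable_twisted`.
No Jacobian, no tube map, no transversal appears here: the analytic content is entirely inside `hone` (paid per member by ★ (B1-T) part 3 from the letter (J̃♭), or by its (3′) twin).
[cite: Rogawski1990, §12.5 pp. 182, 186–187; §4.3 (4.3.1) p. 43; §3.6 pp. 28–31; §3.11 Prop. 3.11.1 pp. 34–35] [cite: HarishChandra1970, Lemma 22; Lemma 42] -/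
theorem isTwistedWeylMeasure_stableCartanMeasure_of_oneTubeFormulas (hns : ∀ w : PlacesOver L v, IsCMField.complexConj L • w.1 = w.1)
    [MeasurableSpace (GtLoc L v)] [BorelSpace (GtLoc L v)] [MeasurableSpace (Gqs L v)] [BorelSpace (Gqs L v)]
    [∀ δ : GtLoc L v, MeasurableSpace (GtLoc L v ⧸ epsCentralizer (epsLoc L (R90.S4.splitFormGL L) v) δ)]
    {C : Finset (Subgroup (Gqs L v))}
    (hZ : ∀ T ∈ C, ∃ γ₀ : Gqs L v, IsRegularElt (γ₀.val : GL (Fin 3) (LocalRing L v)) ∧ T = Subgroup.centralizer ({γ₀} : Set (Gqs L v)))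
    (hcov : ∀ γ : Gqs L v, IsRegularElt (γ.val : GL (Fin 3) (LocalRing L v)) →
      ∃ T ∈ C, ∃ x : Gqs L v, ∀ g : Gqs L v, g ∈ Subgroup.centralizer ({γ} : Set (Gqs L v)) ↔ x⁻¹ * g * x ∈ T)
    (hirr : ∀ T ∈ C, ∀ T' ∈ C, T ≠ T' → ∀ y : Gqs L v, ¬ ∀ h : Gqs L v, h ∈ T' ↔ y⁻¹ * h * y ∈ T)
    (tT : ∀ i : ↥C, Measure ↥(i : Subgroup (Gqs L v))) (htH : ∀ i : ↥C, (tT i).IsHaarMeasure)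
    (htc : ∀ i : ↥C, tT i (compactCore ↥(i : Subgroup (Gqs L v))) = 1)
    {n : Gqs L v → ℕ} (hdict : IsStableTransportDict L v C n)
    (νGt : Measure (GtLoc L v)) [νGt.IsHaarMeasure] [νGt.IsMulRightInvariant]
    (hsing : νGt {δ : GtLoc L v | ¬ IsEpsRegularAt L (R90.S4.splitFormGL L) v δ} = 0)
    (mGt : EpsOrbitalMeasureFamily (epsLoc L (R90.S4.splitFormGL L) v) ⊥)
    (sec₀ : Gqs L v → GtLoc L v) (hsec₀ : ∀ γ : Gqs L v, IsEpsNormPair L (R90.S4.splitFormGL L) v (sec₀ γ) γ)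
    (hwc : IsTwistedWeylCountT L v C n)
    (hone : ∀ (i : ↥C) (γ₀ : Gqs L v), IsRegularElt (γ₀.val : GL (Fin 3) (LocalRing L v)) →
      (i : Subgroup (Gqs L v)) = Subgroup.centralizer ({γ₀} : Set (Gqs L v)) →
      ∀ N' : Subgroup (GtLoc L v),
        (∀ m : GtLoc L v, m ∈ N' ↔
          m ∈ Subgroup.normalizer ((Subgroup.centralizer ({(γ₀.val : GtLoc L v)} : Set (GtLoc L v))) : Set (GtLoc L v)) ∧ m * (epsLoc L (R90.S4.splitFormGL L) v m)⁻¹ ∈ (Subgroup.centralizer ({(γ₀.val : GtLoc L v)} : Set (GtLoc L v)))) →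
      ∀ φ β : GtLoc L v → ℂ, Integrable (fun y => φ y * β y) νGt →
        (∀ δ δ' : GtLoc L v, IsStablyEpsConjAt L (R90.S4.splitFormGL L) v δ δ' → β δ = β δ') →
        IntegrableOn (fun t : ↥((i : ↥C) : Subgroup (Gqs L v)) => (cartanWeight L v ((i : ↥C) : Subgroup (Gqs L v)) t : ℝ) •
            (stableEpsOrbitalIntegral L (R90.S4.splitFormGL L) v mGt φ (sec₀ (t : Gqs L v)) * β (sec₀ (t : Gqs L v))))
          {t : ↥((i : ↥C) : Subgroup (Gqs L v)) | IsRegularElt (((t : Gqs L v)).val : GL (Fin 3) (LocalRing L v))} (tT i) ∧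
        ((((Subgroup.centralizer ({(γ₀.val : GtLoc L v)} : Set (GtLoc L v))).subgroupOf N').index : ℕ) : ℂ) * ∫ y in {δ : GtLoc L v | ∃ t : ↥((i : ↥C) : Subgroup (Gqs L v)), IsRegularElt (((t : Gqs L v)).val : GL (Fin 3) (LocalRing L v)) ∧ IsEpsNormPair L (R90.S4.splitFormGL L) v δ (t : Gqs L v)}, φ y * β y ∂νGt =
          ∫ t in {t : ↥((i : ↥C) : Subgroup (Gqs L v)) | IsRegularElt (((t : Gqs L v)).val : GL (Fin 3) (LocalRing L v))}, (cartanWeight L v ((i : ↥C) : Subgroup (Gqs L v)) t : ℝ) •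
            (stableEpsOrbitalIntegral L (R90.S4.splitFormGL L) v mGt φ (sec₀ (t : Gqs L v)) * β (sec₀ (t : Gqs L v))) ∂(tT i)) :
    IsTwistedWeylMeasure L (R90.S4.splitFormGL L) v νGt mGt (stableCartanMeasure L v C tT n) sec₀ := by
  classical
  intro φ β hφ hβc hβ
  obtain ⟨w⟩ := (inferInstance : Nonempty (PlacesOver L v))
  haveI hH : ∀ i : ↥C, (tT i).IsHaarMeasure := htH
  have hZ' := hZ
  choose γ₀ hγ₀ hTeq using hZ'
  have hmem : ∀ i : ↥C, γ₀ i i.2 ∈ (i : Subgroup (Gqs L v)) := fun i =>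
    (hTeq i i.2).ge (Subgroup.mem_centralizer_iff.mpr fun g hg => by rw [Set.mem_singleton_iff.mp hg])
  obtain ⟨m, τ, e, hst, hwt, hbij, hn, hcount⟩ := id hdict
  -- `φβ` is integrable (`φ ∈ C_c^∞`, `β` continuous, `νGt` locally finite)
  have hφβ : Integrable (fun y => φ y * β y) νGt :=
    (hφ.continuous.mul hβc).integrable_of_hasCompactSupport (hφ.hasCompactSupport.mul_right)
  -- ### notation: tubes, the integrand `G`, the member integrals `J`, the coefficients `a`, the stable classes `S k`
  let tube : ↥C → Set (GtLoc L v) := fun i => {δ : GtLoc L v | ∃ t : ↥((i : ↥C) : Subgroup (Gqs L v)), IsRegularElt (((t : Gqs L v)).val : GL (Fin 3) (LocalRing L v)) ∧ IsEpsNormPair L (R90.S4.splitFormGL L) v δ (t : Gqs L v)}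
  let G : Gqs L v → ℂ := fun γ => stableEpsOrbitalIntegral L (R90.S4.splitFormGL L) v mGt φ (sec₀ γ) * β (sec₀ γ)
  let J : ↥C → ℂ := fun i => ∫ t in {t : ↥((i : ↥C) : Subgroup (Gqs L v)) | IsRegularElt (((t : Gqs L v)).val : GL (Fin 3) (LocalRing L v))}, (cartanWeight L v ((i : ↥C) : Subgroup (Gqs L v)) t : ℝ) • G (t : Gqs L v) ∂(tT i)
  let c' : ↥C → ℝ := fun i => ((((i : ↥C) : Subgroup (Gqs L v)).subgroupOf (Subgroup.normalizer (((i : ↥C) : Subgroup (Gqs L v)) : Set (Gqs L v)))).index : ℝ)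
  let a : ↥C → ℂ := fun i => (((c' i * (m i : ℝ))⁻¹ : ℝ) : ℂ)
  let S : ↥C → Finset ↥C := fun k => Finset.univ.filter fun i : ↥C =>
    ∃ s : ↥((i : ↥C) : Subgroup (Gqs L v)), IsRegularElt (((s : Gqs L v)).val : GL (Fin 3) (LocalRing L v)) ∧
      ∃ s' : ↥((k : ↥C) : Subgroup (Gqs L v)), IsStablyConjGAt L (R90.S4.splitFormGL L) v (s : Gqs L v) (s' : Gqs L v)
  -- ### (1) representatives of the stable classes and the LHS split along their tubes (SING-ε)
  obtain ⟨K, hKdisj, hKcov⟩ := exists_normTube_representatives hns hZ hcov hirr hdict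
  have hLHS : ∫ y, φ y * β y ∂νGt = ∑ k ∈ K, ∫ y in tube k, φ y * β y ∂νGt :=
    integral_eq_sum_integral_normTube hns hZ νGt hsing K hKdisj hKcov _ hφβ
  -- ### (2) ε-normalisers and the one-tube formulas
  have hNex : ∀ k : ↥C, ∃ N' : Subgroup (GtLoc L v), ∀ mm : GtLoc L v, mm ∈ N' ↔
      mm ∈ Subgroup.normalizer ((Subgroup.centralizer ({((γ₀ k k.2).val : GtLoc L v)} : Set (GtLoc L v)) : Subgroup (GtLoc L v)) : Set (GtLoc L v)) ∧
        mm * (epsLoc L (R90.S4.splitFormGL L) v mm)⁻¹ ∈ Subgroup.centralizer ({((γ₀ k k.2).val : GtLoc L v)} : Set (GtLoc L v)) :=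
    fun k => exists_epsNormalizer L (R90.S4.splitFormGL L) v (γ₀ k k.2)
  choose N' hN' using hNex
  have hidx : ∀ k : ↥C, ((Subgroup.centralizer ({((γ₀ k k.2).val : GtLoc L v)} : Set (GtLoc L v))).subgroupOf (N' k)).index ≠ 0 := fun k =>
    index_centralizer_subgroupOf_epsNormalizer_ne_zero L (R90.S4.splitFormGL L) v hns (γ₀ k k.2) (hγ₀ k k.2) (N' k) (hN' k)
  have hone' : ∀ k : ↥C,
      IntegrableOn (fun t : ↥((k : ↥C) : Subgroup (Gqs L v)) => (cartanWeight L v ((k : ↥C) : Subgroup (Gqs L v)) t : ℝ) • G (t : Gqs L v)) {t : ↥((k : ↥C) : Subgroup (Gqs L v)) | IsRegularElt (((t : Gqs L v)).val : GL (Fin 3) (LocalRing L v))} (tT k) ∧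
      ((((Subgroup.centralizer ({((γ₀ k k.2).val : GtLoc L v)} : Set (GtLoc L v))).subgroupOf (N' k)).index : ℕ) : ℂ) * ∫ y in tube k, φ y * β y ∂νGt = J k :=
    fun k => hone k (γ₀ k k.2) (hγ₀ k k.2) (hTeq k k.2) (N' k) (hN' k) φ β hφβ hβ
  have hLk : ∀ k : ↥C, ∫ y in tube k, φ y * β y ∂νGt =
      (((((Subgroup.centralizer ({((γ₀ k k.2).val : GtLoc L v)} : Set (GtLoc L v))).subgroupOf (N' k)).index : ℕ) : ℂ))⁻¹ * J k := fun k =>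
    (eq_inv_mul_iff_mul_eq₀ (Nat.cast_ne_zero.2 (hidx k))).2 (hone' k).2
  -- ### (3) (WEYL-COUNT-T) at the regular family `γ₀`, with `n (γ₀ i) = m i`
  have hak : ∀ k : ↥C, (((((Subgroup.centralizer ({((γ₀ k k.2).val : GtLoc L v)} : Set (GtLoc L v))).subgroupOf (N' k)).index : ℕ) : ℂ))⁻¹ = ∑ i ∈ S k, a i := by
    intro k
    have h1 : ((((Subgroup.centralizer ({((γ₀ k k.2).val : GtLoc L v)} : Set (GtLoc L v))).subgroupOf (N' k)).index : ℝ))⁻¹ =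
        ∑ i ∈ S k, (c' i * (n (γ₀ i i.2) : ℝ))⁻¹ :=
      hwc k ⟨γ₀ k k.2, hmem k⟩ (hγ₀ k k.2) (N' k) (hN' k) (fun i => ⟨γ₀ i i.2, hmem i⟩) (fun i => hγ₀ i i.2)
    have h2 : ((((Subgroup.centralizer ({((γ₀ k k.2).val : GtLoc L v)} : Set (GtLoc L v))).subgroupOf (N' k)).index : ℝ))⁻¹ = ∑ i ∈ S k, (c' i * (m i : ℝ))⁻¹ := by
      rw [h1]
      exact Finset.sum_congr rfl fun i _ => by rw [hn i ⟨γ₀ i i.2, hmem i⟩ (hγ₀ i i.2)]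
    show _ = ∑ i ∈ S k, (((c' i * (m i : ℝ))⁻¹ : ℝ) : ℂ)
    rw [← Complex.ofReal_sum, ← h2, Complex.ofReal_inv, Complex.ofReal_natCast]
  -- ### (4) transport: `J i = J k` whenever `T_i ∼_st T_k`
  have hJ : ∀ k : ↥C, ∀ i ∈ S k, J i = J k := by
    intro k i hi
    obtain ⟨s, hs, s', hss'⟩ := (Finset.mem_filter.1 hi).2
    obtain ⟨e', he', hw'⟩ := exists_transport_of_isStablyConjGAt_of_dict hdict hZ hirr s hs s' hss'
    exact (setIntegral_cartanWeight_smul_stableEpsOrbitalIntegral_mul_eq_of_transport L v hns (isClosed_cartan (hTeq k k.2)) e' he' hw'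
      (tT i) (tT k) (htc i) (htc k) mGt φ β hβ sec₀ hsec₀).symm
  -- ### (5) the stable classes of the representatives partition `C`
  have hpair : ∀ i : ↥C, ∀ δ : GtLoc L v, epsNorm (epsLoc L (R90.S4.splitFormGL L) v) δ = ((γ₀ i i.2).val : GtLoc L v) →
      IsEpsNormPair L (R90.S4.splitFormGL L) v δ (γ₀ i i.2) := fun i δ hNδ => by
    show IsConj (epsNorm (epsLoc L (R90.S4.splitFormGL L) v) δ) ((γ₀ i i.2).val : GtLoc L v)
    rw [hNδ]
  have hcover : ∀ i : ↥C, ∃ k ∈ K, i ∈ S k := by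
    intro i
    obtain ⟨δ, hNδ, -, -⟩ := exists_epsNorm_eq_coe L (R90.S4.splitFormGL L) v (γ₀ i i.2)
    have hδreg : δ ∈ {δ : GtLoc L v | IsEpsRegularAt L (R90.S4.splitFormGL L) v δ} :=
      (isEpsRegularAt_iff_isRegularElt_of_isEpsNormPair (hpair i δ hNδ)).2 (hγ₀ i i.2)
    rw [← hKcov] at hδreg
    obtain ⟨k, hk, t, ht, hδt⟩ : ∃ k ∈ K, ∃ t : ↥((k : ↥C) : Subgroup (Gqs L v)),
        IsRegularElt (((t : Gqs L v)).val : GL (Fin 3) (LocalRing L v)) ∧ IsEpsNormPair L (R90.S4.splitFormGL L) v δ (t : Gqs L v) := by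
      simpa only [Set.mem_iUnion, Set.mem_setOf_eq, exists_prop] using hδreg
    exact ⟨k, hk, Finset.mem_filter.2 ⟨Finset.mem_univ _, ⟨γ₀ i i.2, hmem i⟩, hγ₀ i i.2, t,
      isStablyConjGAt_of_isEpsNormPair_of_isEpsNormPair (hpair i δ hNδ) hδt⟩⟩
  have hdisjS : ∀ k ∈ K, ∀ k' ∈ K, k ≠ k' → Disjoint (S k) (S k') := by
    intro k hk k' hk' hne
    refine Finset.disjoint_left.2 fun i hi hi' => ?_
    obtain ⟨s₁, hs₁, s₁', h₁⟩ := (Finset.mem_filter.1 hi).2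
    obtain ⟨s₂, hs₂, s₂', h₂⟩ := (Finset.mem_filter.1 hi').2
    obtain ⟨e₁, he₁, -⟩ := exists_transport_of_isStablyConjGAt_of_dict hdict hZ hirr s₁ hs₁ s₁' h₁
    obtain ⟨e₂, he₂, -⟩ := exists_transport_of_isStablyConjGAt_of_dict hdict hZ hirr s₂ hs₂ s₂' h₂
    obtain ⟨δ, hNδ, -, -⟩ := exists_epsNorm_eq_coe L (R90.S4.splitFormGL L) v (γ₀ k k.2)
    have hδk : δ ∈ tube k := ⟨⟨γ₀ k k.2, hmem k⟩, hγ₀ k k.2, hpair k δ hNδ⟩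
    have hδi : δ ∈ tube i := (exists_norm_mem_iff_of_transport e₁ he₁ δ).2 hδk
    have hδk' : δ ∈ tube k' := (exists_norm_mem_iff_of_transport e₂ he₂ δ).1 hδi
    exact Set.disjoint_left.1 (hKdisj k hk k' hk' hne) hδk hδk'
  have hunion : K.biUnion S = Finset.univ := Finset.eq_univ_iff_forall.2 fun i => by
    obtain ⟨k, hk, hik⟩ := hcover i
    exact Finset.mem_biUnion.2 ⟨k, hk, hik⟩
  have hPD : (↑K : Set ↥C).PairwiseDisjoint S := fun k hk k' hk' hne => hdisjS k hk k' hk' hne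
  -- ### (6) the right side unpacked on the stable Cartan measure
  have hregm : ∀ i : ↥C, MeasurableSet {t : ↥((i : ↥C) : Subgroup (Gqs L v)) | IsRegularElt (((t : Gqs L v)).val : GL (Fin 3) (LocalRing L v))} := fun i =>
    ((isOpen_setOf_isRegularElt_cmDatum_local (L := L) (H := qsForm L) (v := v) w (hns w)).preimage continuous_subtype_val).measurableSet
  have hemb : ∀ i : ↥C, MeasurableEmbedding ((↑) : ↥((i : ↥C) : Subgroup (Gqs L v)) → Gqs L v) :=
    fun i => MeasurableEmbedding.subtype_coe (isClosed_cartan (hTeq i i.2)).measurableSet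
  have hW : ∀ i : ↥C, Measurable (cartanWeight L v ((i : ↥C) : Subgroup (Gqs L v))) := fun i => measurable_cartanWeight L v hns _
  have hm : ∀ i : ↥C, 0 < m i := fun i => pos_of_bijOn_stableIndexSet (hbij i ⟨γ₀ i i.2, hmem i⟩ (hγ₀ i i.2))
  have hcoef : ∀ i : ↥C, ((((((((i : ↥C) : Subgroup (Gqs L v)).subgroupOf (Subgroup.normalizer (((i : ↥C) : Subgroup (Gqs L v)) : Set (Gqs L v)))).index : ℝ≥0))⁻¹ : ℝ≥0) : ℝ≥0∞) *
      ((m i : ℝ≥0∞))⁻¹).toReal = (c' i * (m i : ℝ))⁻¹ := fun i => by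
    rw [ENNReal.toReal_mul, ENNReal.toReal_inv, ENNReal.coe_toReal, NNReal.coe_inv, NNReal.coe_natCast, ENNReal.toReal_natCast, mul_inv]
  have hRHS : ∫ γ, G γ ∂(stableCartanMeasure L v C tT n) = ∑ i : ↥C, a i * J i := by
    rw [stableCartanMeasure_eq_sum L v hns hZ tT hn, integral_finsetSum_measure fun i _ => ?_]
    · refine Finset.sum_congr rfl fun i _ => ?_
      rw [integral_smul_measure, (hemb i).integral_map, integral_withDensity_eq_integral_smul (hW i), hcoef i, Complex.real_smul]
      simp only [NNReal.smul_def]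
      rfl
    · refine Integrable.smul_measure ?_ (ENNReal.mul_ne_top ENNReal.coe_ne_top (ENNReal.inv_ne_top.2 (Nat.cast_ne_zero.2 (hm i).ne')))
      rw [(hemb i).integrable_map_iff, integrable_withDensity_iff_integrable_smul (hW i)]
      simpa only [NNReal.smul_def, Function.comp_apply] using (hone' i).1.integrable
  -- ### assembly
  calc ∫ y, φ y * β y ∂νGt = ∑ k ∈ K, ∫ y in tube k, φ y * β y ∂νGt := hLHS
    _ = ∑ k ∈ K, ∑ i ∈ S k, a i * J k := by
        refine Finset.sum_congr rfl fun k _ => ?_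
        rw [hLk k, hak k, Finset.sum_mul]
    _ = ∑ k ∈ K, ∑ i ∈ S k, a i * J i := by
        refine Finset.sum_congr rfl fun k _ => Finset.sum_congr rfl fun i hi => ?_
        rw [hJ k i hi]
    _ = ∑ i ∈ K.biUnion S, a i * J i := (Finset.sum_biUnion hPD).symm
    _ = ∑ i : ↥C, a i * J i := by rw [hunion]
    _ = ∫ γ, G γ ∂(stableCartanMeasure L v C tT n) := hRHS.symm

end SigmaCore

end Summit.HodgeConjecture.HodgeConjecture.R90.S4

end
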